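import Mathlib
import Literature.AlgebraicGeometry.Ramification.InertiaNormalSylow
import HarnessLib

/-!
# Groups with a normal Sylow `p`-subgroup: extensions by `p`-groups, products, subdirect products

More API for `Literature.AlgebraicGeometry.Ramification.HasNormalSylow` (Abbes–Saito's (NpS)
condition "the inertia group has a normal Sylow `p`-subgroup", i.e. the group is *p-closed*),
complementing `HasNormalSylow.subgroup` / `.of_surjective` of `InertiaNormalSylow.lean`:

* `HasNormalSylow.of_isPGroup_of_quotient` — an extension of a p-closed group BY a normal
  `p`-group is p-closed. Consequence used in the inertia-stratum analysis of wild quotient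
  singularities ("Phase 0" of crux stmt-ResolutionOfSingularities-15640): the *p-closed residual*
  `R(Π) = ⋂ {N ⊴ Π : Π/N p-closed}` of a NON-p-closed group `Π` is never a `p`-group — so it
  contains an element of order prime to `p`.
* `HasNormalSylow.prod` — products of p-closed groups are p-closed.
* `HasNormalSylow.quotient_inf` — p-closed quotients are closed under subdirect products:
  `Π/N₁`, `Π/N₂` p-closed ⇒ `Π/(N₁ ∩ N₂)` p-closed. Hence (finite `Π`) the p-closed residual is
  the least normal subgroup with p-closed quotient.
-/

namespace Literature.AlgebraicGeometry.Ramification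

variable {p : ℕ} {G : Type*} [Group G]

/-- **Extensions of p-closed groups by normal `p`-groups are p-closed**: if `N ⊴ G` is a `p`-group
and `G/N` has a normal Sylow `p`-subgroup `P̄`, then the preimage of `P̄` is a normal Sylow
`p`-subgroup of `G`. In particular the p-closed residual of a non-p-closed finite group is not a
`p`-group. [folklore] -/
theorem HasNormalSylow.of_isPGroup_of_quotient [Fact p.Prime] [Finite G] (N : Subgroup G)
    [N.Normal] (hN : IsPGroup p N) (hQ : HasNormalSylow p (G ⧸ N)) : HasNormalSylow p G := by
  obtain ⟨P, hP⟩ := hQ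
  haveI := hP
  have hker : IsPGroup p (QuotientGroup.mk' N).ker := by rwa [QuotientGroup.ker_mk']
  refine HasNormalSylow.of_normal_of_not_dvd_index ((P : Subgroup (G ⧸ N)).comap
    (QuotientGroup.mk' N)) (P.isPGroup'.comap_of_ker_isPGroup (QuotientGroup.mk' N) hker) ?_
  rw [Subgroup.index_comap_of_surjective _ (QuotientGroup.mk'_surjective N)]
  exact P.not_dvd_index

/-- **Products of p-closed groups are p-closed**: `P × Q` is a normal Sylow `p`-subgroup of
`G × H` when `P`, `Q` are normal Sylow `p`-subgroups of `G`, `H`. [folklore] -/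
theorem HasNormalSylow.prod [Fact p.Prime] [Finite G] {H : Type*} [Group H] [Finite H]
    (hG : HasNormalSylow p G) (hH : HasNormalSylow p H) : HasNormalSylow p (G × H) := by
  obtain ⟨P, hP⟩ := hG
  obtain ⟨Q, hQ⟩ := hH
  haveI := hP; haveI := hQ
  have hpg : IsPGroup p ((P : Subgroup G).prod (Q : Subgroup H)) := by
    intro ⟨⟨a, b⟩, hab⟩
    obtain ⟨i, hi⟩ := P.isPGroup' ⟨a, hab.1⟩
    obtain ⟨j, hj⟩ := Q.isPGroup' ⟨b, hab.2⟩
    refine ⟨i + j, Subtype.ext ?_⟩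
    have hi' : a ^ p ^ i = 1 := congrArg Subtype.val hi
    have hj' : b ^ p ^ j = 1 := congrArg Subtype.val hj
    change (a, b) ^ p ^ (i + j) = 1
    ext
    · simp only [Prod.pow_fst, Prod.fst_one, pow_add, pow_mul, hi', one_pow]
    · simp only [Prod.pow_snd, Prod.snd_one, pow_add, pow_mul', hj', one_pow]
  refine HasNormalSylow.of_normal_of_not_dvd_index ((P : Subgroup G).prod (Q : Subgroup H))
    hpg ?_
  rw [Subgroup.index_prod]
  intro hdvd
  rcases (Nat.Prime.dvd_mul (Fact.out : p.Prime)).mp hdvd with h | h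
  · exact P.not_dvd_index h
  · exact Q.not_dvd_index h

/-- Transport of `HasNormalSylow` along a group isomorphism. [folklore] -/
theorem HasNormalSylow.of_mulEquiv [Fact p.Prime] [Finite G] {H : Type*} [Group H]
    (h : HasNormalSylow p G) (e : G ≃* H) : HasNormalSylow p H :=
  h.of_surjective e.toMonoidHom e.surjective

/-- **p-closed quotients are closed under subdirect products**: if `G/N₁` and `G/N₂` have normal
Sylow `p`-subgroups then so does `G/(N₁ ∩ N₂)`, a subgroup of `G/N₁ × G/N₂`. [folklore] -/
theorem HasNormalSylow.quotient_inf [Fact p.Prime] [Finite G] (N₁ N₂ : Subgroup G) [N₁.Normal]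
    [N₂.Normal] (h₁ : HasNormalSylow p (G ⧸ N₁)) (h₂ : HasNormalSylow p (G ⧸ N₂)) :
    HasNormalSylow p (G ⧸ (N₁ ⊓ N₂)) := by
  let f : G →* (G ⧸ N₁) × (G ⧸ N₂) := (QuotientGroup.mk' N₁).prod (QuotientGroup.mk' N₂)
  have hker : f.ker = N₁ ⊓ N₂ := by
    rw [MonoidHom.ker_prod, QuotientGroup.ker_mk', QuotientGroup.ker_mk']
  have hrange : HasNormalSylow p f.range := (h₁.prod h₂).subgroup f.range
  have e : G ⧸ (N₁ ⊓ N₂) ≃* f.range :=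
    (QuotientGroup.quotientMulEquivOfEq hker.symm).trans (QuotientGroup.quotientKerEquivRange f)
  exact hrange.of_mulEquiv e.symm

/-- **The p-closed residual exists.** In a finite group `G` there is a least normal subgroup
`R` with `G/R` p-closed (having a normal Sylow `p`-subgroup): the family of normal subgroups with
p-closed quotient contains `⊤`, is finite, and is closed under `⊓` (`HasNormalSylow.quotient_inf`),
so a minimal member is least. `R(G) ≠ 1` iff `G` is not p-closed, and `R(G)` is never a
non-trivial `p`-group (`HasNormalSylow.of_isPGroup_of_quotient`). [folklore] -/
theorem exists_pClosedResidual [Fact p.Prime] [Finite G] :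
    ∃ (R : Subgroup G) (_ : R.Normal), HasNormalSylow p (G ⧸ R) ∧
      ∀ (N : Subgroup G) [N.Normal], HasNormalSylow p (G ⧸ N) → R ≤ N := by
  classical
  let S : Set (Subgroup G) := {N | ∃ _ : N.Normal, HasNormalSylow p (G ⧸ N)}
  haveI : Finite (Subgroup G) :=
    Finite.of_injective (fun H : Subgroup G => (H : Set G)) SetLike.coe_injective
  have hSfin : S.Finite := Set.toFinite S
  have htop : (⊤ : Subgroup G) ∈ S := by
    refine ⟨inferInstance, ?_⟩
    haveI : Subsingleton (G ⧸ (⊤ : Subgroup G)) := QuotientGroup.subsingleton_quotient_top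
    exact HasNormalSylow.of_isPGroup (IsPGroup.of_card (n := 0) (by simp))
  obtain ⟨R, hRmin⟩ := hSfin.exists_minimal ⟨⊤, htop⟩
  obtain ⟨hRn, hR⟩ := hRmin.prop
  refine ⟨R, hRn, hR, fun N hN hNS => ?_⟩
  haveI := hRn
  have hinf : R ⊓ N ∈ S := ⟨inferInstance, HasNormalSylow.quotient_inf R N hR hNS⟩
  have : R ⊓ N = R := hRmin.eq_of_le hinf inf_le_left
  exact this ▸ inf_le_right

end Literature.AlgebraicGeometry.Ramification
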